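import Summits.HodgeConjecture.CorCM.MumfordTateRankRibetTypeOne
import Summits.HodgeConjecture.CorCM.MumfordTateRankTypeOneRelDimTwo
import HarnessLib

/-!
# Simple abelian FOURFOLDS with a quadratic endomorphism field: `t = 21` (real quadratic, I(2)), `t = 17` (imaginary quadratic,
# multiplicities `(3,1)`), or Weil type `(2,2)` with `t ≤ 17` (Moonen–Zarhin 1995)

COR-CM (cell `pub-hodgecm2`, seat `b27` gen 46, count-neutral Mumford–Tate-rank ladder; theorems only, no definition, no named fact;
UNCONDITIONAL — nothing here uses or asserts HC_CM).  The row «`dim_ℚ End⁰B = 2`» of the fourfold atlas, assembled from this gen's rungs: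
for a SIMPLE complex abelian fourfold `B` whose endomorphism algebra has `ℚ`-dimension `2`, `End⁰B` is a quadratic FIELD (Mumford §19), and by
the tree's Riemann dichotomy it is
* TOTALLY REAL — type I(2), real multiplication of relative dimension two: **`t = 21`**, `dim Lie Hg(H¹B) = 20`
  (`CorCM/MumfordTateRankTypeOneRelDimTwo`: `Hg = R_{F/ℚ} Sp_{4,F}`); or
* a CM field, i.e. IMAGINARY QUADRATIC — `φ ∘ φ = −d` for some `φ`, the multiplicities `(n′, n″)` of `φ` on `H^{1,0}` are positive (Shimura
  Prop. 14) with `n′ + n″ = 4`: either `{n′, n″} = {3, 1}` (Ribet type, IV(1,1) (i)): **`t = 17`**, `dim Lie Hg = 16` (`Hg = U_F(V, ψ)`,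
  `CorCM/MumfordTateRankRibetTypeOne`), or `n′ = n″ = 2` (WEIL TYPE): **`t ≤ 17`** (the unitary Lefschetz bound `dim Lef(ψ) = 16` of
  `CorCM/LefschetzAlgebraCMField`; generically `Hg = SU(2,2)`-type with exceptional Weil classes — not decided here).

* **`mtRank_hodge_one_of_isSimple_fourfold_of_finrank_endAlgebra_eq_two`** — the trichotomy; **`mtRank_hodge_one_le_seventeen_or_eq_twentyone_…`**.

## References
* [MoonenZarhin1995Duke] B. Moonen, Yu. G. Zarhin, *Hodge classes and Tate classes on simple abelian fourfolds*, Duke Math. J. 77 (1995)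
  (Types I(2), IV(1,1)).
* [MoonenZarhin1999LowDim] B. Moonen, Yu. G. Zarhin, Math. Ann. 315 (1999), §2 (2.4).
* [Ribet1983] K. A. Ribet, Amer. J. Math. 105 (1983), Thm. 3.
* [Shimura1963AnalyticFamilies] G. Shimura, Ann. of Math. 78 (1963), §4 Prop. 14.
-/

noncomputable section

open scoped TensorProduct
open CategoryTheory Module NumberField

namespace Summit.HodgeConjecture.CorCM

open Literature.AlgebraicGeometry.Motives
open Literature.AlgebraicGeometry.Motives.AbelianVariety
open Literature.AlgebraicGeometry.Motives.HodgeStructure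
open Literature.AlgebraicGeometry.HodgeTheory
open Literature.AlgebraicGeometry.ComplexMultiplication

variable [HodgeTensorFacts.{0, 0}] {A : AbelianVariety ℂ}

omit [HodgeTensorFacts.{0, 0}] in
/-- A CM field is not totally real (it has an infinite place, which is complex). [folklore] -/
private theorem not_isTotallyReal_of_isCMField (K : Type) [Field K] [NumberField K] [IsCMField K] : ¬ IsTotallyReal K := by
  intro hR
  obtain ⟨w⟩ := (inferInstance : Nonempty (InfinitePlace K))
  exact (InfinitePlace.not_isReal_iff_isComplex.2 (IsTotallyComplex.isComplex w)) (hR.isReal w)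

/-- **A SIMPLE abelian FOURFOLD with `dim_ℚ End⁰B = 2`: `t = 21` (real quadratic `End⁰`, type I(2)), or `t = 17` (imaginary quadratic, Ribet
type `(3,1)`), or Weil type — `φ ∘ φ = −d` with multiplicities `(2,2)` — with `t ≤ 17`.** [cite: MoonenZarhin1995Duke, Types I(2) and IV(1,1)]
[cite: MoonenZarhin1999LowDim, §2 (2.4)] [cite: Ribet1983, Thm. 3] [cite: Shimura1963AnalyticFamilies, §4 Prop. 14] -/
theorem mtRank_hodge_one_of_isSimple_fourfold_of_finrank_endAlgebra_eq_two {n : ℕ} (hX : IsSmoothProjective n A.X) (hA : A.IsSimple)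
    (h4 : A.dim = 4) (hE2 : Module.finrank ℚ A.endAlgebra = 2) :
    haveI := BettiUniverse.finite hX 1
    ((∃ hF : IsField A.endAlgebra, IsTotallyReal (EndField A hF)) ∧ (BettiUniverse.hodge exists_isReal_hodgeModel_holds hX 1).mtRank = 21) ∨
      ((∃ (φ : A ⟶ A) (d : ℕ), 0 < d ∧ φ ≫ φ = -(d • 𝟙 A) ∧
          (eigenMultiplicity A φ (Complex.I * (Real.sqrt d : ℂ)) = 1 ∨ eigenMultiplicity A φ (-(Complex.I * (Real.sqrt d : ℂ))) = 1)) ∧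
        (BettiUniverse.hodge exists_isReal_hodgeModel_holds hX 1).mtRank = 17) ∨
      ((∃ (φ : A ⟶ A) (d : ℕ), 0 < d ∧ φ ≫ φ = -(d • 𝟙 A) ∧
          eigenMultiplicity A φ (Complex.I * (Real.sqrt d : ℂ)) = 2 ∧ eigenMultiplicity A φ (-(Complex.I * (Real.sqrt d : ℂ))) = 2) ∧
        (BettiUniverse.hodge exists_isReal_hodgeModel_holds hX 1).mtRank ≤ 17) := by
  classical
  have hk : A.dim = n := schemeDim_eq_holds hX
  subst hk
  haveI := BettiUniverse.finite hX 1
  have h0 : 0 < A.dim := by omega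
  have hF : IsField A.endAlgebra := AbelianVariety.isField_endAlgebra_of_isSimple_of_finrank_eq_two hA h0 hE2
  rcases isTotallyReal_or_isCMField_endField_of_riemann hF deligneMilne1982_Thm_6_20_full_holds h0 with hR | hCM
  · haveI := hR
    exact Or.inl ⟨⟨hF, hR⟩, (mtRank_hodge_one_of_fourfold_real_quadratic_field hF hX h4 hE2).1⟩
  · haveI := hCM
    have hnR : ¬ IsTotallyReal (EndField A hF) := not_isTotallyReal_of_isCMField (EndField A hF)
    obtain ⟨a, q, hq, ha⟩ := AbelianVariety.exists_mul_self_eq_neg_of_finrank_eq_two h0 hE2 hF hnR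
    obtain ⟨φ, d, hd, hφ⟩ := AbelianVariety.exists_hom_comp_self_eq_neg A hq ha
    have hsum := eigenMultiplicity_add_eigenMultiplicity_neg_eq_dim A φ hd hφ
    have hpos := AbelianVariety.eigenMultiplicity_pos_of_isSimple A hA φ hd hφ (by omega)
    by_cases h1 : eigenMultiplicity A φ (Complex.I * (Real.sqrt d : ℂ)) = 1 ∨ eigenMultiplicity A φ (-(Complex.I * (Real.sqrt d : ℂ))) = 1
    · have h := (mtRank_hodge_one_of_ribetTypeOne' hX hF hnR φ hd hφ hE2 h1 (by omega)).1
      have h17 : A.dim * A.dim + 1 = 17 := by rw [h4]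
      exact Or.inr (Or.inl ⟨⟨φ, d, hd, hφ, h1⟩, h.trans h17⟩)
    · have h22 : eigenMultiplicity A φ (Complex.I * (Real.sqrt d : ℂ)) = 2 ∧
          eigenMultiplicity A φ (-(Complex.I * (Real.sqrt d : ℂ))) = 2 := by omega
      obtain ⟨ψ⟩ := BettiUniverse.hodge_isPolarizable exists_isReal_hodgeModel_holds hX 1
      have hK : Module.finrank ℚ (EndField A hF) = 2 := by rw [EndField.finrank_eq hF, hE2]
      obtain ⟨-, hle⟩ := finrank_lefschetz_eq_sq_of_isCMField_of_finrank_eq_two h0 (EndField.toEndAlgebra hF).toRingHom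
        (EndField.toEndAlgebra hF).bijective hK ψ
      have h17 : A.dim * A.dim + 1 = 17 := by rw [h4]
      exact Or.inr (Or.inr ⟨⟨φ, d, hd, hφ, h22⟩, hle.trans h17.le⟩)

/-- **A simple abelian fourfold with `dim_ℚ End⁰B = 2` has `dim MT(H¹B) = 21` or `dim MT(H¹B) ≤ 17`** (`21 ⟺` real quadratic `End⁰`).
[cite: MoonenZarhin1995Duke, Types I(2) and IV(1,1)] [cite: MoonenZarhin1999LowDim, §2 (2.4)] -/
theorem mtRank_hodge_one_le_seventeen_or_eq_twentyone_of_isSimple_fourfold_of_finrank_endAlgebra_eq_two {n : ℕ}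
    (hX : IsSmoothProjective n A.X) (hA : A.IsSimple) (h4 : A.dim = 4) (hE2 : Module.finrank ℚ A.endAlgebra = 2) :
    haveI := BettiUniverse.finite hX 1
    (BettiUniverse.hodge exists_isReal_hodgeModel_holds hX 1).mtRank ≤ 17 ∨
      (BettiUniverse.hodge exists_isReal_hodgeModel_holds hX 1).mtRank = 21 := by
  rcases mtRank_hodge_one_of_isSimple_fourfold_of_finrank_endAlgebra_eq_two hX hA h4 hE2 with ⟨-, h⟩ | ⟨-, h⟩ | ⟨-, h⟩
  · exact Or.inr h
  · exact Or.inl (by omega)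
  · exact Or.inl h

/-- **`t = 21` singles out real multiplication among simple fourfolds with quadratic `End⁰`**: `dim MT(H¹B) = 21 ⟺ End⁰B` is totally real.
[cite: MoonenZarhin1995Duke, Types I(2) and IV(1,1)] -/
theorem mtRank_hodge_one_eq_twentyone_iff_isTotallyReal_of_isSimple_fourfold {n : ℕ} (hX : IsSmoothProjective n A.X) (hA : A.IsSimple)
    (h4 : A.dim = 4) (hE2 : Module.finrank ℚ A.endAlgebra = 2) (hF : IsField A.endAlgebra) :
    haveI := BettiUniverse.finite hX 1
    (BettiUniverse.hodge exists_isReal_hodgeModel_holds hX 1).mtRank = 21 ↔ IsTotallyReal (EndField A hF) := by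
  haveI := BettiUniverse.finite hX 1
  refine ⟨fun h => ?_, fun hR => (mtRank_hodge_one_of_fourfold_real_quadratic_field hF hX h4 hE2).1⟩
  have h0 : 0 < A.dim := by omega
  rcases isTotallyReal_or_isCMField_endField_of_riemann hF deligneMilne1982_Thm_6_20_full_holds h0 with hR | hCM
  · exact hR
  · exfalso
    haveI := hCM
    rcases mtRank_hodge_one_of_isSimple_fourfold_of_finrank_endAlgebra_eq_two hX hA h4 hE2 with ⟨⟨hF', hR'⟩, -⟩ | ⟨-, h'⟩ | ⟨-, h'⟩
    · exact not_isTotallyReal_of_isCMField (EndField A hF) hR'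
    · omega
    · omega

end Summit.HodgeConjecture.CorCM

end
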